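import Literature.MathematicalPhysics.QuantumLattice.HubbardTTPrimeThermalPressureLimit
import Literature.MathematicalPhysics.QuantumLattice.SpinSectorPartitionFnParticleHole
import HarnessLib

/-!
# Particle–hole symmetry of the thermal pressure of the 2D `t–t'` Hubbard model:
# `p(β; t, t', U; n) = βU(1 − n) + p(β; t, −t', U; 2 − n)` for EVERY filling `0 < n < 2`

Topic `MathematicalPhysics/QuantumLattice` (family `hubbard`); sequel of `HubbardTTPrimeThermalPressureLimit.lean`
(`pressureTT' β t t' U n = lim_L L⁻² log Re Z_β(sectorHamiltonianTT' t t' U n L)`) and of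
`SpinSectorPartitionFnParticleHole.lean` (on an EVEN torus the particle–hole map carries the canonical sector
`k = halfRectN n L` of `H_L(t,t',U)` onto the sector `L² − k` of `H_L(t,−t',U)`, with the energy shift `U(L² − 2k)`:
`partitionFn_sectorHamiltonianTT'_particleHole`). The finite-volume identity is record-to-record only when
`nL²/2 ∈ ℤ`; in general the image sector `L² − k` and the sector of record `halfRectN (2−n) L` at the reflected filling
differ by ONE electron pair (`halfRectN (2−n) L + halfRectN n L ∈ {L² − 1, L²}`, §1), and that pair is priced by the
compressibility bound of `CanonicalPartitionFnAdjacentSectors.lean` (`O(log L²) + O(β)`, i.e. `o(L²)`):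

* §1 `halfRectN_two_sub_add_le`, `sq_le_halfRectN_two_sub_add_succ` — the two sectors of record are complementary up
  to one pair;
* §2 `log_partitionFn_sectorHamiltonianTT'_particleHole_ge` — on every even torus,
  `βU(L² − 2k) + log Re Z_β(sectorHamiltonianTT' t (−t') U (2−n) L) − A_L ≤ log Re Z_β(sectorHamiltonianTT' t t' U n L)`
  with the one-pair price `A_L = 2(log L² + βK L²/(L² − halfRectN (2−n) L))`, `K = 18(2|t|+U) + 36|t'|`;
* §3 **`pressureTT'_particleHole`** — in the limit along the even tori (where all three sequences converge by
  `tendsto_sectorPressureTT'`): `p(β; t,t',U; n) ≥ βU(1−n) + p(β; t,−t',U; 2−n)`, and the same inequality for the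
  reflected data gives EQUALITY; hence every certified pressure row at filling `n` (hole-doped side) is a row at
  filling `2 − n` with `t' ↦ −t'` (electron-doped side) and conversely (`le_pressureTT'_two_sub_iff`-type corollaries),
  the `T > 0` twin of `energyDensityTT'_particleHole`.

Everything is PROVED; no definition, no named fact.

## Mathlib / tree search

REUSED: `partitionFn_sectorHamiltonianTT'_particleHole` (`SpinSectorPartitionFnParticleHole`),
`partitionFn_spinSector_hubbardTorusTT'_eq_rect`, `partitionFn_sectorHamiltonianTT'_eq_spinSector` (`TorusSectorGibbsOpenBoxBound`),
`log_partitionFn_spinSector_le_succ_succ` (`CanonicalPartitionFnAdjacentSectors`), `tendsto_sectorPressureTT'`,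
`card_filter_fermionRectTorusDiagGraph_adj_le_four`, `halfRectN_lt_sq` (`HubbardTTPrimeThermalPressureLimit`),
`card_filter_fermionRectTorusGraph_adj_le` (`HubbardTorus2DTiling`), `rectN_le`, `lt_rectN_add_two`, `tendsto_rectN_div_sq`,
Mathlib `le_of_tendsto_of_tendsto`, `tendsto_const_div_atTop_nhds_zero_nat`. `lean search 'pressure.*particleHole'`: nothing (2026-08-27).

## References

* E. H. Lieb, F. Y. Wu, Physica A 321 (2003) 1, §1 eq. (3) (particle–hole transformation of the Hubbard model on a
  bipartite lattice). [cite: LiebWuPhysicaA2003, §1 eq. (3)]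
* D. Ruelle, *Statistical Mechanics: Rigorous Results* (1969), §3.4 (particle-number changes cost `o(V)`).
  [cite: Ruelle1969, §3.4]
-/

noncomputable section

namespace Literature.MathematicalPhysics.QuantumLattice

open Matrix Finset HubbardWave0 Literature.Probability.LatticeModels LiebThm1
open _root_.Filter
open scoped _root_.Topology ComplexOrder BigOperators

namespace ThermodynamicLimit

/-! ### §1 The two sectors of record are complementary up to one pair -/

/-- `halfRectN (2−n) L + halfRectN n L ≤ L²` (`0 ≤ n ≤ 2`): `⌊y⌋ + ⌊x⌋ ≤ x + y = L²`.
[cite: LiebWuPhysicaA2003, §1 eq. (3)] -/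
theorem halfRectN_two_sub_add_le {n : ℝ} (hn0 : 0 ≤ n) (hn2 : n ≤ 2) (L : ℕ) :
    halfRectN (2 - n) L + halfRectN n L ≤ L ^ 2 := by
  have h1 := rectN_le hn0 L
  have h2 := rectN_le (sub_nonneg.2 hn2) L
  have e1 : (rectN n L : ℝ) = 2 * halfRectN n L := by exact_mod_cast (rfl : rectN n L = 2 * halfRectN n L)
  have e2 : (rectN (2 - n) L : ℝ) = 2 * halfRectN (2 - n) L := by
    exact_mod_cast (rfl : rectN (2 - n) L = 2 * halfRectN (2 - n) L)
  rw [e1] at h1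
  rw [e2] at h2
  have h : ((halfRectN (2 - n) L + halfRectN n L : ℕ) : ℝ) ≤ ((L ^ 2 : ℕ) : ℝ) := by push_cast; nlinarith
  exact_mod_cast h

/-- `L² ≤ halfRectN (2−n) L + halfRectN n L + 1`: `x + y = L² < (⌊x⌋ + 1) + (⌊y⌋ + 1)`.
[cite: LiebWuPhysicaA2003, §1 eq. (3)] -/
theorem sq_le_halfRectN_two_sub_add_succ (n : ℝ) (L : ℕ) :
    L ^ 2 ≤ halfRectN (2 - n) L + halfRectN n L + 1 := by
  have h1 := lt_rectN_add_two n L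
  have h2 := lt_rectN_add_two (2 - n) L
  have e1 : (rectN n L : ℝ) = 2 * halfRectN n L := by exact_mod_cast (rfl : rectN n L = 2 * halfRectN n L)
  have e2 : (rectN (2 - n) L : ℝ) = 2 * halfRectN (2 - n) L := by
    exact_mod_cast (rfl : rectN (2 - n) L = 2 * halfRectN (2 - n) L)
  rw [e1] at h1
  rw [e2] at h2
  have h : ((L ^ 2 : ℕ) : ℝ) < ((halfRectN (2 - n) L + halfRectN n L + 2 : ℕ) : ℝ) := by push_cast; nlinarith
  have h' : L ^ 2 < halfRectN (2 - n) L + halfRectN n L + 2 := by exact_mod_cast h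
  omega

/-! ### §2 Finite volume: the particle–hole image of the canonical partition function, priced -/

/-- **The one-pair price of the particle–hole rounding.** On an even torus `L × L` (`0 ≤ n ≤ 2`, `β ≥ 0`,
`k' + 1 ≤ L²`, `k' = halfRectN (2−n) L`):
`βU(L² − 2·halfRectN n L) + log Re Z_β(sectorHamiltonianTT' t (−t') U (2−n) L) − A_L ≤ log Re Z_β(sectorHamiltonianTT' t t' U n L)`
with `A_L = 2(log L² + βK·L²/(L² − k'))`, `K = 9·2(2|t|+|U|) + 9·2(2|−t'|+0)` — the particle–hole identity of
`SpinSectorPartitionFnParticleHole` followed, when the two sectors of record miss each other by one pair, by the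
compressibility bound. [cite: LiebWuPhysicaA2003, §1 eq. (3)] [cite: Ruelle1969, §3.4] -/
theorem log_partitionFn_sectorHamiltonianTT'_particleHole_ge {L : ℕ} (hL : Even L) (β t t' U : ℝ) (hβ : 0 ≤ β)
    {n : ℝ} (hn0 : 0 ≤ n) (hn2 : n ≤ 2) (hk' : halfRectN (2 - n) L + 1 ≤ L * L) :
    β * U * ((L : ℝ) ^ 2 - 2 * halfRectN n L) +
        Real.log (partitionFn β (sectorHamiltonianTT' t (-t') U (2 - n) L)).re -
        2 * (Real.log (Fintype.card (Fin L ×ₗ Fin L)) +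
          β * ((2 * 4 + 1 : ℕ) * (2 * (2 * |t| + |U|)) + (2 * 4 + 1 : ℕ) * (2 * (2 * |(-t')| + |(0 : ℝ)|))) *
            Fintype.card (Fin L ×ₗ Fin L) / (Fintype.card (Fin L ×ₗ Fin L) - halfRectN (2 - n) L)) ≤
      Real.log (partitionFn β (sectorHamiltonianTT' t t' U n L)).re := by
  -- positivity of the partition functions involved
  have hHrect : (hubbardRectTorusTT' L L t (-t') U).IsHermitian := hubbardRectTorusTT'_isHermitian L L t (-t') U
  have hZpos : ∀ a : ℕ, a ≤ L * L →
      0 < (partitionFn β (spinSectorHamiltonian a a (hubbardRectTorusTT' L L t (-t') U))).re := by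
    intro a ha
    have ha' : a ≤ Fintype.card (Fin L ×ₗ Fin L) := by rw [card_rectSites]; exact ha
    haveI := nonempty_spinConfig (Λ := Fin L ×ₗ Fin L) ha' ha'
    exact partitionFn_spinSector_re_pos hHrect β
  -- the two sectors of record: complementary up to one pair
  have h1 := halfRectN_two_sub_add_le hn0 hn2 L
  have h2 := sq_le_halfRectN_two_sub_add_succ n L
  have hle : halfRectN n L ≤ L ^ 2 := le_trans (Nat.le_add_left _ _) h1
  -- the particle–hole identity, in real logarithmic form on the rectangular torus
  have hPH := partitionFn_sectorHamiltonianTT'_particleHole hL β t t' U hn0 hn2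
  rw [partitionFn_spinSector_hubbardTorusTT'_eq_rect] at hPH
  have hPHre : (partitionFn β (sectorHamiltonianTT' t t' U n L)).re =
      Real.exp (β * U * ((L : ℝ) ^ 2 - 2 * halfRectN n L)) *
        (partitionFn β (spinSectorHamiltonian (L ^ 2 - halfRectN n L) (L ^ 2 - halfRectN n L)
          (hubbardRectTorusTT' L L t (-t') U))).re := by
    rw [hPH, Complex.re_ofReal_mul]
  have hZimg : 0 < (partitionFn β (spinSectorHamiltonian (L ^ 2 - halfRectN n L) (L ^ 2 - halfRectN n L)
      (hubbardRectTorusTT' L L t (-t') U))).re := hZpos _ (by rw [sq]; omega)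
  rw [hPHre, Real.log_mul (Real.exp_pos _).ne' hZimg.ne', Real.log_exp, log_partitionFn_sectorHamiltonianTT'_eq_rect]
  -- the price is nonnegative
  have hcard1 : (1 : ℝ) ≤ Fintype.card (Fin L ×ₗ Fin L) := by
    rw [card_rectSites]; exact_mod_cast (by omega : 1 ≤ L * L)
  have hden : 0 < (Fintype.card (Fin L ×ₗ Fin L) : ℝ) - halfRectN (2 - n) L := by
    rw [card_rectSites]
    have : ((halfRectN (2 - n) L : ℕ) : ℝ) < ((L * L : ℕ) : ℝ) := by exact_mod_cast (by omega : halfRectN (2 - n) L < L * L)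
    linarith
  have hA0 : 0 ≤ 2 * (Real.log (Fintype.card (Fin L ×ₗ Fin L)) +
      β * ((2 * 4 + 1 : ℕ) * (2 * (2 * |t| + |U|)) + (2 * 4 + 1 : ℕ) * (2 * (2 * |(-t')| + |(0 : ℝ)|))) *
        Fintype.card (Fin L ×ₗ Fin L) / (Fintype.card (Fin L ×ₗ Fin L) - halfRectN (2 - n) L)) := by
    have hlog : 0 ≤ Real.log (Fintype.card (Fin L ×ₗ Fin L)) := Real.log_nonneg hcard1
    have hK0 : 0 ≤ β * ((2 * 4 + 1 : ℕ) * (2 * (2 * |t| + |U|)) + (2 * 4 + 1 : ℕ) * (2 * (2 * |(-t')| + |(0 : ℝ)|))) :=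
      mul_nonneg hβ (by positivity)
    have hfrac : 0 ≤ β * ((2 * 4 + 1 : ℕ) * (2 * (2 * |t| + |U|)) + (2 * 4 + 1 : ℕ) * (2 * (2 * |(-t')| + |(0 : ℝ)|))) *
        Fintype.card (Fin L ×ₗ Fin L) / (Fintype.card (Fin L ×ₗ Fin L) - halfRectN (2 - n) L) :=
      div_nonneg (mul_nonneg hK0 (Nat.cast_nonneg _)) hden.le
    linarith
  -- case analysis: the two sectors coincide, or differ by one pair
  rcases Nat.eq_or_lt_of_le h1 with heq | hlt
  · -- `k' + k = L²`: the image sector IS the sector of record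
    have e : L ^ 2 - halfRectN n L = halfRectN (2 - n) L := by omega
    have hZeq : (partitionFn β (spinSectorHamiltonian (L ^ 2 - halfRectN n L) (L ^ 2 - halfRectN n L)
        (hubbardRectTorusTT' L L t (-t') U))).re =
        (partitionFn β (spinSectorHamiltonian (halfRectN (2 - n) L) (halfRectN (2 - n) L)
          (hubbardRectTorusTT' L L t (-t') U))).re := by rw [e]
    rw [hZeq]
    linarith
  · -- `k' + k + 1 = L²`: one extra pair, priced by compressibility
    have e : L ^ 2 - halfRectN n L = halfRectN (2 - n) L + 1 := by omega
    have hZeq : (partitionFn β (spinSectorHamiltonian (L ^ 2 - halfRectN n L) (L ^ 2 - halfRectN n L)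
        (hubbardRectTorusTT' L L t (-t') U))).re =
        (partitionFn β (spinSectorHamiltonian (halfRectN (2 - n) L + 1) (halfRectN (2 - n) L + 1)
          (hubbardRectTorusTT' L L t (-t') U))).re := by rw [e]
    rw [hZeq]
    have hk'1 : halfRectN (2 - n) L + 1 ≤ Fintype.card (Fin L ×ₗ Fin L) := by rw [card_rectSites]; exact hk'
    have hstep := log_partitionFn_spinSector_le_succ_succ (fermionRectTorusGraph L L) (fermionRectTorusDiagGraph L L)
      (card_filter_fermionRectTorusGraph_adj_le L L) (card_filter_fermionRectTorusDiagGraph_adj_le_four L L)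
      t U (-t') 0 hβ hk'1
    have hstep' : Real.log (partitionFn β (spinSectorHamiltonian (halfRectN (2 - n) L) (halfRectN (2 - n) L)
        (hubbardRectTorusTT' L L t (-t') U))).re ≤
        2 * (Real.log (Fintype.card (Fin L ×ₗ Fin L)) +
          β * ((2 * 4 + 1 : ℕ) * (2 * (2 * |t| + |U|)) + (2 * 4 + 1 : ℕ) * (2 * (2 * |(-t')| + |(0 : ℝ)|))) *
            Fintype.card (Fin L ×ₗ Fin L) / (Fintype.card (Fin L ×ₗ Fin L) - halfRectN (2 - n) L)) +
        Real.log (partitionFn β (spinSectorHamiltonian (halfRectN (2 - n) L + 1) (halfRectN (2 - n) L + 1)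
          (hubbardRectTorusTT' L L t (-t') U))).re := by
      unfold hubbardRectTorusTT'
      exact hstep
    linarith

/-- **The one-pair price is `o(L²)`**: for `0 < n`, eventually in `L`,
`A_L / L² ≤ (4 + 8βK/n) / L` where `A_L` is the price above (`log L² ≤ 2L`, `L² − halfRectN (2−n) L ≥ halfRectN n L ≥ nL²/4`).
[cite: Ruelle1969, §3.4] -/
theorem eventually_particleHole_price_div_sq_le (β t t' U : ℝ) (hβ : 0 ≤ β) {n : ℝ} (hn0 : 0 < n) (hn2 : n ≤ 2) :
    ∀ᶠ L : ℕ in atTop,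
      2 * (Real.log (Fintype.card (Fin L ×ₗ Fin L)) +
          β * ((2 * 4 + 1 : ℕ) * (2 * (2 * |t| + |U|)) + (2 * 4 + 1 : ℕ) * (2 * (2 * |(-t')| + |(0 : ℝ)|))) *
            Fintype.card (Fin L ×ₗ Fin L) / (Fintype.card (Fin L ×ₗ Fin L) - halfRectN (2 - n) L)) / (L : ℝ) ^ 2 ≤
        (4 + 8 * β * ((2 * 4 + 1 : ℕ) * (2 * (2 * |t| + |U|)) + (2 * 4 + 1 : ℕ) * (2 * (2 * |(-t')| + |(0 : ℝ)|))) / n) /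
          (L : ℝ) := by
  set K : ℝ := (2 * 4 + 1 : ℕ) * (2 * (2 * |t| + |U|)) + (2 * 4 + 1 : ℕ) * (2 * (2 * |(-t')| + |(0 : ℝ)|)) with hK
  have hK0 : 0 ≤ K := by rw [hK]; positivity
  clear_value K
  -- eventually `n L² ≥ 4`, so that `halfRectN n L ≥ nL²/2 − 1 ≥ nL²/4`
  have hev : ∀ᶠ L : ℕ in atTop, 4 ≤ n * (L : ℝ) ^ 2 := by
    have ht : Tendsto (fun L : ℕ => n * (L : ℝ) ^ 2) atTop atTop :=
      Tendsto.const_mul_atTop hn0 ((tendsto_pow_atTop two_ne_zero).comp tendsto_natCast_atTop_atTop)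
    exact ht.eventually_ge_atTop 4
  filter_upwards [hev, eventually_ge_atTop 1] with L hL4 hL1
  have hLpos : (0 : ℝ) < L := by exact_mod_cast hL1
  have hL2 : (0 : ℝ) < (L : ℝ) ^ 2 := by positivity
  rw [card_rectSites]
  have hV : ((L * L : ℕ) : ℝ) = (L : ℝ) ^ 2 := by push_cast; ring
  rw [hV]
  -- the two summands
  have hlog : Real.log ((L : ℝ) ^ 2) ≤ 2 * L := by
    rw [Real.log_pow]; push_cast
    have := Real.log_le_sub_one_of_pos hLpos
    linarith
  have hk : n * (L : ℝ) ^ 2 / 2 - 1 < halfRectN n L := by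
    have h := lt_rectN_add_two n L
    have e1 : (rectN n L : ℝ) = 2 * halfRectN n L := by exact_mod_cast (rfl : rectN n L = 2 * halfRectN n L)
    rw [e1] at h; linarith
  have hk' : ((halfRectN (2 - n) L : ℕ) : ℝ) + halfRectN n L ≤ (L : ℝ) ^ 2 := by
    have h := halfRectN_two_sub_add_le hn0.le hn2 L
    exact_mod_cast h
  have hden : n * (L : ℝ) ^ 2 / 4 ≤ (L : ℝ) ^ 2 - halfRectN (2 - n) L := by linarith
  have hden0 : 0 < n * (L : ℝ) ^ 2 / 4 := by positivity
  have hfrac : β * K * (L : ℝ) ^ 2 / ((L : ℝ) ^ 2 - halfRectN (2 - n) L) ≤ 4 * β * K / n := by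
    calc β * K * (L : ℝ) ^ 2 / ((L : ℝ) ^ 2 - halfRectN (2 - n) L)
        ≤ β * K * (L : ℝ) ^ 2 / (n * (L : ℝ) ^ 2 / 4) := div_le_div_of_nonneg_left (by positivity) hden0 hden
      _ = 4 * β * K / n := by
          rw [div_eq_div_iff (ne_of_gt hden0) hn0.ne']
          ring
  rw [div_le_div_iff₀ hL2 hLpos]
  have h1 : 2 * (Real.log ((L : ℝ) ^ 2) + β * K * (L : ℝ) ^ 2 / ((L : ℝ) ^ 2 - halfRectN (2 - n) L)) ≤
      2 * (2 * L + 4 * β * K / n) := by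
    exact mul_le_mul_of_nonneg_left (add_le_add hlog hfrac) (by norm_num)
  have hL1' : (1 : ℝ) ≤ L := by exact_mod_cast hL1
  have h2 : 2 * (2 * (L : ℝ) + 4 * β * K / n) * L ≤ (4 + 8 * β * K / n) * (L : ℝ) ^ 2 := by
    have h3 : 0 ≤ 8 * β * K / n * ((L : ℝ) ^ 2 - L) := by
      have : (0 : ℝ) ≤ (L : ℝ) ^ 2 - L := by nlinarith
      positivity
    rw [← sub_nonneg]
    have e : (4 + 8 * β * K / n) * (L : ℝ) ^ 2 - 2 * (2 * (L : ℝ) + 4 * β * K / n) * L =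
        8 * β * K / n * ((L : ℝ) ^ 2 - L) := by ring
    rw [e]
    exact h3
  calc 2 * (Real.log ((L : ℝ) ^ 2) + β * K * (L : ℝ) ^ 2 / ((L : ℝ) ^ 2 - halfRectN (2 - n) L)) * L
      ≤ 2 * (2 * (L : ℝ) + 4 * β * K / n) * L := mul_le_mul_of_nonneg_right h1 hLpos.le
    _ ≤ (4 + 8 * β * K / n) * (L : ℝ) ^ 2 := h2

/-! ### §3 The limit -/

/-- **One-sided particle–hole inequality for the pressure** (`β ≥ 0`, `U ≥ 0`, `0 < n < 2`):
`βU(1 − n) + p(β; t, −t', U; 2 − n) ≤ p(β; t, t', U; n)` — the even-torus identity per volume, the one-pair price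
being `o(1)`, and the existence of the three limits. [cite: LiebWuPhysicaA2003, §1 eq. (3)] [cite: Ruelle1969, §3.4] -/
theorem mul_add_pressureTT'_two_sub_le {β : ℝ} (hβ : 0 ≤ β) (t t' : ℝ) {U : ℝ} (hU : 0 ≤ U) {n : ℝ}
    (hn0 : 0 < n) (hn2 : n < 2) :
    β * U * (1 - n) + pressureTT' β t (-t') U (2 - n) ≤ pressureTT' β t t' U n := by
  have hn0' : 0 ≤ 2 - n := by linarith
  have hn2' : 2 - n < 2 := by linarith
  -- the even side sequence
  set Ls : ℕ → ℕ := fun m => 2 * (m + 1) with hLs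
  have hLs_t : Tendsto Ls atTop atTop := by
    refine tendsto_atTop_atTop.2 fun b => ⟨b, fun m hm => ?_⟩
    simp only [hLs]; omega
  have hLs_even : ∀ m, Even (Ls m) := fun m => ⟨m + 1, by simp only [hLs]; ring⟩
  have hLs_pos : ∀ m, 1 ≤ Ls m := fun m => by simp only [hLs]; omega
  -- the three convergent sequences along `Ls`
  have hp := tendsto_log_partitionFn_div_sq_comp hβ t t' hU hn0.le hn2 hLs_t
  have hq := tendsto_log_partitionFn_div_sq_comp hβ t (-t') hU hn0' hn2' hLs_t
  have hk : Tendsto (fun m => β * U * (1 - 2 * ((halfRectN n (Ls m) : ℝ) / (Ls m : ℝ) ^ 2))) atTop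
      (𝓝 (β * U * (1 - n))) := by
    have h := (tendsto_rectN_div_sq hn0.le).comp hLs_t
    have h' : Tendsto (fun m => 2 * ((halfRectN n (Ls m) : ℝ) / (Ls m : ℝ) ^ 2)) atTop (𝓝 n) := by
      refine h.congr fun m => ?_
      simp only [Function.comp]
      have e1 : (rectN n (Ls m) : ℝ) = 2 * halfRectN n (Ls m) := by
        exact_mod_cast (rfl : rectN n (Ls m) = 2 * halfRectN n (Ls m))
      rw [e1]; ring
    exact ((h'.const_sub 1).const_mul (β * U))
  -- the price tends to zero
  have hprice0 : Tendsto (fun m : ℕ =>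
      (4 + 8 * β * ((2 * 4 + 1 : ℕ) * (2 * (2 * |t| + |U|)) + (2 * 4 + 1 : ℕ) * (2 * (2 * |(-t')| + |(0 : ℝ)|))) / n) /
        (Ls m : ℝ)) atTop (𝓝 0) := by
    have h := (tendsto_const_div_atTop_nhds_zero_nat
      (4 + 8 * β * ((2 * 4 + 1 : ℕ) * (2 * (2 * |t| + |U|)) + (2 * 4 + 1 : ℕ) * (2 * (2 * |(-t')| + |(0 : ℝ)|))) / n)).comp
      hLs_t
    exact h
  -- the finite-volume inequality per volume, eventually along `Ls`
  have hprice := hLs_t.eventually (eventually_particleHole_price_div_sq_le β t t' U hβ hn0 hn2.le)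
  have hroom : ∀ᶠ m in atTop, halfRectN (2 - n) (Ls m) + 1 ≤ Ls m * Ls m := by
    have hev : ∀ᶠ L : ℕ in atTop, 2 ≤ n * (L : ℝ) ^ 2 := by
      have ht : Tendsto (fun L : ℕ => n * (L : ℝ) ^ 2) atTop atTop :=
        Tendsto.const_mul_atTop hn0 ((tendsto_pow_atTop two_ne_zero).comp tendsto_natCast_atTop_atTop)
      exact ht.eventually_ge_atTop 2
    filter_upwards [hLs_t.eventually hev] with m hm
    -- `halfRectN n L ≥ 1` and `halfRectN (2−n) L + halfRectN n L ≤ L²`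
    have h1 := halfRectN_two_sub_add_le hn0.le hn2.le (Ls m)
    have h2 : 1 ≤ halfRectN n (Ls m) := by
      have h := lt_rectN_add_two n (Ls m)
      have e1 : (rectN n (Ls m) : ℝ) = 2 * halfRectN n (Ls m) := by
        exact_mod_cast (rfl : rectN n (Ls m) = 2 * halfRectN n (Ls m))
      rw [e1] at h
      have : (0 : ℝ) < halfRectN n (Ls m) := by linarith
      exact_mod_cast this
    rw [sq] at h1
    omega
  have hineq : ∀ᶠ m in atTop,
      β * U * (1 - 2 * ((halfRectN n (Ls m) : ℝ) / (Ls m : ℝ) ^ 2)) +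
        Real.log (partitionFn β (sectorHamiltonianTT' t (-t') U (2 - n) (Ls m))).re / (Ls m : ℝ) ^ 2 -
        (4 + 8 * β * ((2 * 4 + 1 : ℕ) * (2 * (2 * |t| + |U|)) + (2 * 4 + 1 : ℕ) * (2 * (2 * |(-t')| + |(0 : ℝ)|))) / n) /
          (Ls m : ℝ) ≤
      Real.log (partitionFn β (sectorHamiltonianTT' t t' U n (Ls m))).re / (Ls m : ℝ) ^ 2 := by
    filter_upwards [hprice, hroom] with m hpm hrm
    have hL2 : (0 : ℝ) < (Ls m : ℝ) ^ 2 := by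
      have : (1 : ℝ) ≤ Ls m := by exact_mod_cast hLs_pos m
      positivity
    have hfin := log_partitionFn_sectorHamiltonianTT'_particleHole_ge (hLs_even m) β t t' U hβ hn0.le hn2.le hrm
    have hfin' := div_le_div_of_nonneg_right hfin hL2.le
    rw [sub_div, add_div] at hfin'
    have hL0 : (Ls m : ℝ) ≠ 0 := by
      have : (1 : ℝ) ≤ Ls m := by exact_mod_cast hLs_pos m
      positivity
    have e : β * U * ((Ls m : ℝ) ^ 2 - 2 * halfRectN n (Ls m)) / (Ls m : ℝ) ^ 2 =
        β * U * (1 - 2 * ((halfRectN n (Ls m) : ℝ) / (Ls m : ℝ) ^ 2)) := by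
      field_simp
    rw [e] at hfin'
    linarith
  have hlim := le_of_tendsto_of_tendsto ((hk.add hq).sub hprice0) hp hineq
  simpa using hlim

/-- **Particle–hole symmetry of the thermal pressure** (`β ≥ 0`, `U ≥ 0`, `0 < n < 2`):
`p(β; t, t', U; n) = βU(1 − n) + p(β; t, −t', U; 2 − n)` — hole doping `n` of the `(t, t')` model and electron
doping `2 − n` of the `(t, −t')` model have the same free entropy up to the explicit `βU(1−n)`; the `T > 0` twin of
`energyDensityTT'_particleHole`. [cite: LiebWuPhysicaA2003, §1 eq. (3)] -/
theorem pressureTT'_particleHole {β : ℝ} (hβ : 0 ≤ β) (t t' : ℝ) {U : ℝ} (hU : 0 ≤ U) {n : ℝ} (hn0 : 0 < n)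
    (hn2 : n < 2) :
    pressureTT' β t t' U n = β * U * (1 - n) + pressureTT' β t (-t') U (2 - n) := by
  have h1 := mul_add_pressureTT'_two_sub_le hβ t t' hU hn0 hn2
  have h2 := mul_add_pressureTT'_two_sub_le hβ t (-t') hU (n := 2 - n) (by linarith) (by linarith)
  rw [neg_neg, show 2 - (2 - n) = n by ring] at h2
  linarith

/-- **Reflected floors**: a certified pressure floor at the reflected data is a floor at the original filling,
`W ≤ p(β; t, −t', U; 2−n) ⇒ W + βU(1−n) ≤ p(β; t, t', U; n)`. [cite: LiebWuPhysicaA2003, §1 eq. (3)] -/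
theorem add_le_pressureTT'_of_le_reflected {β : ℝ} (hβ : 0 ≤ β) (t t' : ℝ) {U : ℝ} (hU : 0 ≤ U) {n : ℝ}
    (hn0 : 0 < n) (hn2 : n < 2) {W : ℝ} (hW : W ≤ pressureTT' β t (-t') U (2 - n)) :
    W + β * U * (1 - n) ≤ pressureTT' β t t' U n := by
  rw [pressureTT'_particleHole hβ t t' hU hn0 hn2]; linarith

/-- **Reflected ceilings**: `p(β; t, −t', U; 2−n) ≤ u ⇒ p(β; t, t', U; n) ≤ u + βU(1−n)`.
[cite: LiebWuPhysicaA2003, §1 eq. (3)] -/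
theorem pressureTT'_le_add_of_reflected_le {β : ℝ} (hβ : 0 ≤ β) (t t' : ℝ) {U : ℝ} (hU : 0 ≤ U) {n : ℝ}
    (hn0 : 0 < n) (hn2 : n < 2) {u : ℝ} (hu : pressureTT' β t (-t') U (2 - n) ≤ u) :
    pressureTT' β t t' U n ≤ u + β * U * (1 - n) := by
  rw [pressureTT'_particleHole hβ t t' hU hn0 hn2]; linarith

/-- **At half filling** the pressure is even in `t'`: `p(β; t, t', U; 1) = p(β; t, −t', U; 1)`.
[cite: LiebWuPhysicaA2003, §1 eq. (3)] -/
theorem pressureTT'_halfFilling_neg_tPrime {β : ℝ} (hβ : 0 ≤ β) (t t' : ℝ) {U : ℝ} (hU : 0 ≤ U) :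
    pressureTT' β t t' U 1 = pressureTT' β t (-t') U 1 := by
  have h := pressureTT'_particleHole hβ t t' hU one_pos one_lt_two
  norm_num at h
  exact h

end ThermodynamicLimit

end Literature.MathematicalPhysics.QuantumLattice
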